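import Literature.MathematicalPhysics.QuantumLattice.FreeFermionPressureQuadrature
import HarnessLib

/-!
# Kernel-checked quadrature for the free-fermion grand-canonical pressure `P₀(β, t', μ)` of the `t–t'` square lattice

Topic `MathematicalPhysics/QuantumLattice` (family `hubbard`); written 2026-08-28 by `hubbard-downfold-unc-2` (g25, MO-S1 filling
lane) as the `t' ≠ 0` twin of hubbard-tc mod-2's `FreeFermionPressureQuadrature` (whose §1 — nodes `u_p`, certified hat integrals
`Ω_p ≤ omegaPlus N p`, the `2·arctan` tables — is REUSED verbatim).

The integrand of `freeGCPressureTT' β t' μ` (`HubbardTTPrimeFreeGCPressure`) in the two cosines `a = cos p₀`, `b = cos p₁` is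
`g(a,b) = 2 log(1 + e^{β(μ − 2a − 2b + 4t'ab)})`: NOT a function of `a + b`, but still CONVEX IN EACH VARIABLE SEPARATELY (the
exponent is affine in `a` at fixed `b`), which is all the product hat-function majorant `setIntegral_brillouin_two_le_sum_hat`
(`CosineHatMajorant`) asks. The only change in the table bound is a fourth exponential factor `e^{4βt'u_p u_q}` per PAIR of nodes,
enclosed in the kernel by ONE `expPos` call per pair (`expUpper` / `expLower`, no positivity side-check needed).

* §1 `expUpper` / `expLower` (one-sided enclosures of `eʸ`, `|y| ≤ 32`, sound without a positivity check) and `rdn_nonneg`;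
* §2 the integrand `gRTT'` (nonnegative, continuous, separately convex) and the table bound `gBoundTT' ≥ g(u_p, u_q)`;
* §3 the Boolean `checkTT'` and **`integral_le_of_checkTT'`**:
  `checkTT' β t' μ N emu L P = true → (2π)⁻² ∫_{[−π,π]²} 2 log(1 + e^{−β(2Σcos kᵢ − 4t' cos k₀ cos k₁ − μ)}) dk ≤ P`,
  stated on the EXPLICIT integrand (so that this file does not import `HubbardTTPrimeFreeGCPressure`; the one-line bridge
  `freeGCPressureTT' β t' μ ≤ P` is `by unfold freeGCPressureTT' freeLogWeightTT'; exact …` at the consumer).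

One `decide +kernel` per node then discharges a ceiling (`Summits/…/Certificates/HubbardTTPrime_freeGC_kernelQuadrature_*.lean`);
at `N = 24` (49 × 49 nodes, 2401 pair exponentials) the second-order slack is `≈ 10⁻²` on `P₀ ≈ 5` at `β·t = 8`.

Everything is PROVED (standard axioms). HONEST FRAMING: one-body numerics (an upper bound on an explicit integral); nothing here is
a statement about the Hubbard model beyond the free gas.

## Mathlib / tree search

REUSED: `FreeGCQuadrature.{nodeU, uR, omegaPlus, omegaR, omegaR_le_omegaPlus, omegaR_nonneg, uR_lt_succ, uR_zero_and_last, Entry,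
entryOK, entriesOK, sumOver, ExpOK, piLo, convexOn_two_mul_log_one_add_exp}` (`FreeFermionPressureQuadrature`); `expPos`,
`expPos_spec`, `expEncl`, `expEncl_spec`, `rup`, `rdn`, `le_rup`, `rdn_le`, `cast_le_rup`, `rdn_cast_le`, `log1pUpper`,
`log_one_add_le_log1pUpper`, `log2Hi` (`KernelDyadicEnclosures`); `setIntegral_brillouin_two_le_sum_hat` (`CosineHatMajorant`).
`rg 'QuadratureTT|gRTT'` over `lean/`: nothing (2026-08-28).

References: Davis–Rabinowitz §2.1 / §5.6 (one-sided trapezoid for convex integrands; product rules) [cite: DavisRabinowitz1984, Sect. 2.1];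
Abramowitz–Stegun 4.2.1 / 4.1.24 [cite: AbramowitzStegun1964, 4.2.1]; Ashcroft–Mermin Ch. 2 (2.49) (the free grand potential)
[cite: AshcroftMermin1976, Ch. 2 eq. (2.49)].
-/

noncomputable section

namespace Literature.MathematicalPhysics.QuantumLattice

namespace FreeGCQuadrature

open Real Set MeasureTheory Finset Literature.Probability.LatticeModels
open Literature.Analysis.Quadrature.KernelQuadrature
open scoped BigOperators

/-! ### §1 One-sided exponential enclosures without a positivity side-check -/

/-- `rdn q ≥ 0` for `q ≥ 0`. [cite: DavisRabinowitz1984, Sect. 4.2] -/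
theorem rdn_nonneg {q : ℚ} (hq : 0 ≤ q) : 0 ≤ rdn q := by
  unfold rdn
  have hdy : (0 : ℚ) < dy := by unfold dy; norm_num
  exact div_nonneg (by exact_mod_cast Int.floor_nonneg.2 (mul_nonneg hq hdy.le)) hdy.le

/-- **Upper enclosure of `eʸ`** (`|y| ≤ 32`): `expPos` for `y ≥ 0`; for `y < 0` the reciprocal of the lower end of `expPos (-y)`
when that end is positive, else the trivial bound `1`. [cite: AbramowitzStegun1964, 4.2.1] -/
def expUpper (y : ℚ) : ℚ :=
  if 0 ≤ y then (expPos y).2 else if 0 < (expPos (-y)).1 then rup (1 / (expPos (-y)).1) else 1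

/-- **Lower enclosure of `eʸ`** (`|y| ≤ 32`): `expPos` for `y ≥ 0`; for `y < 0` the reciprocal of the upper end of
`expPos (-y)`. [cite: AbramowitzStegun1964, 4.2.1] -/
def expLower (y : ℚ) : ℚ :=
  if 0 ≤ y then (expPos y).1 else rdn (1 / (expPos (-y)).2)

/-- Soundness of `expUpper`. [cite: AbramowitzStegun1964, 4.2.1] -/
theorem exp_le_expUpper (y : ℚ) (hy : |y| ≤ 32) : Real.exp (y : ℝ) ≤ ((expUpper y : ℚ) : ℝ) := by
  unfold expUpper
  by_cases h0 : 0 ≤ y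
  · rw [if_pos h0]
    rw [abs_of_nonneg h0] at hy
    exact (expPos_spec y h0 hy).2
  · rw [if_neg h0]
    have hyneg : y < 0 := lt_of_not_ge h0
    rw [abs_of_neg hyneg] at hy
    have hsp := expPos_spec (-y) (by linarith) hy
    push_cast at hsp
    by_cases hp : 0 < (expPos (-y)).1
    · rw [if_pos hp]
      apply cast_le_rup
      push_cast
      have hlo_pos : (0 : ℝ) < (((expPos (-y)).1 : ℚ) : ℝ) := by exact_mod_cast hp
      have hexp : Real.exp (y : ℝ) = 1 / Real.exp (-(y : ℝ)) := by rw [Real.exp_neg]; simp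
      rw [hexp]
      exact one_div_le_one_div_of_le hlo_pos hsp.1
    · rw [if_neg hp]
      push_cast
      exact Real.exp_le_one_iff.2 (by exact_mod_cast hyneg.le)

/-- Soundness of `expLower`. [cite: AbramowitzStegun1964, 4.2.1] -/
theorem expLower_le_exp (y : ℚ) (hy : |y| ≤ 32) : ((expLower y : ℚ) : ℝ) ≤ Real.exp (y : ℝ) := by
  unfold expLower
  by_cases h0 : 0 ≤ y
  · rw [if_pos h0]
    rw [abs_of_nonneg h0] at hy
    exact (expPos_spec y h0 hy).1
  · rw [if_neg h0]
    have hyneg : y < 0 := lt_of_not_ge h0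
    rw [abs_of_neg hyneg] at hy
    have hsp := expPos_spec (-y) (by linarith) hy
    push_cast at hsp
    apply rdn_cast_le
    push_cast
    have hexp : Real.exp (y : ℝ) = 1 / Real.exp (-(y : ℝ)) := by rw [Real.exp_neg]; simp
    rw [hexp]
    exact one_div_le_one_div_of_le (Real.exp_pos _) hsp.2

/-- `expLower y ≥ 0`. [cite: AbramowitzStegun1964, 4.2.1] -/
theorem expLower_nonneg (y : ℚ) (hy : |y| ≤ 32) : 0 ≤ ((expLower y : ℚ) : ℝ) := by
  unfold expLower
  by_cases h0 : 0 ≤ y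
  · rw [if_pos h0]
    -- `expPos` ends with a squaring step whose lower end is `rdn` of a square
    show (0 : ℝ) ≤ (((expPos y).1 : ℚ) : ℝ)
    have : 0 ≤ (expPos y).1 := by
      unfold expPos
      exact rdn_nonneg (mul_nonneg (le_max_right _ _) (le_max_right _ _))
    exact_mod_cast this
  · rw [if_neg h0]
    have hyneg : y < 0 := lt_of_not_ge h0
    rw [abs_of_neg hyneg] at hy
    have hsp := expPos_spec (-y) (by linarith) hy
    have h2 : (0 : ℝ) ≤ (((expPos (-y)).2 : ℚ) : ℝ) := (Real.exp_pos _).le.trans hsp.2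
    have h2q : 0 ≤ (expPos (-y)).2 := by exact_mod_cast h2
    exact_mod_cast rdn_nonneg (div_nonneg zero_le_one h2q)

/-! ### §2 The `t–t'` integrand and the table bound -/

/-- The free `t–t'` log-weight as a function of the two cosines: `g(a,b) = 2 log(1 + e^{β(μ − 2a − 2b + 4t'ab)})`.
[cite: AshcroftMermin1976, Ch. 2 eq. (2.49)] -/
def gRTT' (β t' μ : ℚ) (a b : ℝ) : ℝ :=
  2 * Real.log (1 + Real.exp ((β : ℝ) * (μ - 2 * a - 2 * b + 4 * t' * (a * b))))

/-- `g ≥ 0`, continuous, convex in each cosine SEPARATELY (the exponent is affine in each variable at the other fixed).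
[cite: HardyLittlewoodPolya1952, §3.5] -/
theorem gRTT'_props (β t' μ : ℚ) :
    (∀ a b, 0 ≤ gRTT' β t' μ a b) ∧ (Continuous fun ab : ℝ × ℝ => gRTT' β t' μ ab.1 ab.2) ∧
      (∀ b, ConvexOn ℝ (Icc (-1 : ℝ) 1) (fun a => gRTT' β t' μ a b)) ∧
      (∀ a, ConvexOn ℝ (Icc (-1 : ℝ) 1) (gRTT' β t' μ a)) := by
  have hconv := convexOn_two_mul_log_one_add_exp
  have haff : ∀ c d : ℝ, ConvexOn ℝ (Icc (-1 : ℝ) 1) (fun x : ℝ => 2 * Real.log (1 + Real.exp (c * x + d))) := by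
    intro c d
    refine ConvexOn.subset ?_ (subset_univ _) (convex_Icc _ _)
    refine ⟨convex_univ, fun x _ y _ p q hp hq hpq => ?_⟩
    have h := hconv.2 (mem_univ (c * x + d)) (mem_univ (c * y + d)) hp hq hpq
    have e : p • (c * x + d) + q • (c * y + d) = c * (p • x + q • y) + d := by
      simp only [smul_eq_mul]
      rw [show q = 1 - p by linarith]
      ring
    rw [e] at h
    exact h
  refine ⟨fun a b => ?_, ?_, fun b => ?_, fun a => ?_⟩
  · unfold gRTT'
    exact mul_nonneg zero_le_two (Real.log_nonneg (by linarith [Real.exp_pos ((β : ℝ) * (μ - 2 * a - 2 * b + 4 * t' * (a * b)))]))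
  · unfold gRTT'
    have hlin : Continuous fun ab : ℝ × ℝ => (β : ℝ) * (μ - 2 * ab.1 - 2 * ab.2 + 4 * t' * (ab.1 * ab.2)) := by continuity
    have hpos : ∀ ab : ℝ × ℝ, 1 + Real.exp ((β : ℝ) * (μ - 2 * ab.1 - 2 * ab.2 + 4 * t' * (ab.1 * ab.2))) ≠ 0 :=
      fun ab => by positivity
    exact continuous_const.mul ((continuous_const.add (Real.continuous_exp.comp hlin)).log hpos)
  · have h := haff ((β : ℝ) * (-2 + 4 * t' * b)) ((β : ℝ) * (μ - 2 * b))
    refine h.congr fun a _ => ?_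
    unfold gRTT'; ring_nf
  · have h := haff ((β : ℝ) * (-2 + 4 * t' * a)) ((β : ℝ) * (μ - 2 * a))
    refine h.congr fun b _ => ?_
    unfold gRTT'; ring_nf

/-- `0.6931471808 ≥ log 2`. [cite: AbramowitzStegun1964, 4.1.24] -/
private theorem log_two_le_log2Hi' : Real.log 2 ≤ ((log2Hi : ℚ) : ℝ) := by
  have h := Real.log_two_lt_d9
  push_cast [log2Hi]
  norm_num at h ⊢
  linarith

/-- The exponent at a node pair: `w_{pq} = β(μ − 2u_p − 2u_q + 4t'u_p u_q)`. [cite: DavisRabinowitz1984, Sect. 2.1] -/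
def wPair (β t' μ : ℚ) (N : ℕ) (p q : ℕ) : ℚ :=
  β * (μ - 2 * nodeU N p - 2 * nodeU N q + 4 * t' * (nodeU N p * nodeU N q))

/-- The pair exponent `y_{pq} = 4βt' u_p u_q` of the cross factor. [cite: DavisRabinowitz1984, Sect. 2.1] -/
def yPair (β t' : ℚ) (N : ℕ) (p q : ℕ) : ℚ := 4 * β * t' * (nodeU N p * nodeU N q)

/-- **The table bound `G_pq`** on `g(u_p, u_q) = 2 log (1 + eʷ)`, `w = w_{pq}`: for `w ≤ 0` through the product of the four
upper exp-enclosures `e^{βμ}·e^{−2βu_p}·e^{−2βu_q}·e^{4βt'u_pu_q}`; for `w > 0` as `w + log(1 + e^{-w})` through the lower ones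
(fallback `log 2`). [cite: AbramowitzStegun1964, 4.1.24] -/
def gBoundTT' (β t' μ : ℚ) (N : ℕ) (emu : ℚ × ℚ) (e f : Entry) : ℚ :=
  if wPair β t' μ N e.idx f.idx ≤ 0 then
    rup (2 * log1pUpper (rup (rup (rup (emu.2 * e.ehi) * f.ehi) * expUpper (yPair β t' N e.idx f.idx))))
  else
    rup (2 * (wPair β t' μ N e.idx f.idx +
      (if 0 < rdn (rdn (rdn (emu.1 * e.elo) * f.elo) * expLower (yPair β t' N e.idx f.idx)) then
        log1pUpper (rup (1 / rdn (rdn (rdn (emu.1 * e.elo) * f.elo) * expLower (yPair β t' N e.idx f.idx))))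
       else log2Hi)))

/-- **Soundness of `gBoundTT'`**: valid enclosures (with positive lower ends) and `|4βt'| ≤ 32` ⟹ `g(u_p, u_q) ≤ gBoundTT'`.
[cite: AbramowitzStegun1964, 4.1.24] -/
theorem gRTT'_le_gBoundTT' (β t' μ : ℚ) (N : ℕ) (hN : 1 ≤ N) (emu : ℚ × ℚ) (e f : Entry)
    (hmu : ExpOK ((β : ℝ) * μ) emu.1 emu.2)
    (he : ExpOK (-2 * (β : ℝ) * uR N e.idx) e.elo e.ehi) (hf : ExpOK (-2 * (β : ℝ) * uR N f.idx) f.elo f.ehi)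
    (heM : e.idx ≤ 2 * N) (hfM : f.idx ≤ 2 * N) (hb4 : |4 * β * t'| ≤ 32) :
    gRTT' β t' μ (uR N e.idx) (uR N f.idx) ≤ ((gBoundTT' β t' μ N emu e f : ℚ) : ℝ) := by
  obtain ⟨hmu0, hmu1, hmu2⟩ := hmu
  obtain ⟨he0, he1, he2⟩ := he
  obtain ⟨hf0, hf1, hf2⟩ := hf
  -- the cross factor
  have hu : ∀ p ≤ 2 * N, |nodeU N p| ≤ 1 := by
    intro p hp
    have h01 := uR_zero_and_last hN
    have hmono : ∀ a b, a ≤ b → b ≤ 2 * N → uR N a ≤ uR N b := by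
      intro a b hab hbM
      induction b, hab using Nat.le_induction with
      | base => exact le_rfl
      | succ b hab ih => exact (ih (by omega)).trans (uR_lt_succ hN b (by omega)).le
    have hlo := hmono 0 p (Nat.zero_le _) hp
    have hhi := hmono p (2 * N) hp le_rfl
    rw [h01.1] at hlo; rw [h01.2] at hhi
    unfold uR at hlo hhi
    rw [abs_le]
    exact ⟨by exact_mod_cast hlo, by exact_mod_cast hhi⟩
  have hy32 : |yPair β t' N e.idx f.idx| ≤ 32 := by
    unfold yPair
    rw [abs_mul, abs_mul (nodeU N e.idx)]
    have h1 := hu e.idx heM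
    have h2 := hu f.idx hfM
    have hprod : |nodeU N e.idx| * |nodeU N f.idx| ≤ 1 := by
      calc |nodeU N e.idx| * |nodeU N f.idx| ≤ 1 * 1 := mul_le_mul h1 h2 (abs_nonneg _) zero_le_one
        _ = 1 := one_mul 1
    calc |4 * β * t'| * (|nodeU N e.idx| * |nodeU N f.idx|) ≤ |4 * β * t'| * 1 :=
          mul_le_mul_of_nonneg_left hprod (abs_nonneg _)
      _ ≤ 32 := by rw [mul_one]; exact hb4
  have hyU := exp_le_expUpper _ hy32
  have hyL := expLower_le_exp _ hy32
  have hyL0 := expLower_nonneg _ hy32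
  have hycast : (((yPair β t' N e.idx f.idx : ℚ)) : ℝ) = 4 * (β : ℝ) * t' * (uR N e.idx * uR N f.idx) := by
    unfold yPair uR; push_cast; ring
  rw [hycast] at hyU hyL
  set wq : ℚ := wPair β t' μ N e.idx f.idx with hwq
  have hw : ((wq : ℚ) : ℝ) = (β : ℝ) * (μ - 2 * uR N e.idx - 2 * uR N f.idx + 4 * t' * (uR N e.idx * uR N f.idx)) := by
    rw [hwq]; unfold wPair uR; push_cast; ring
  have hfac : Real.exp ((β : ℝ) * (μ - 2 * uR N e.idx - 2 * uR N f.idx + 4 * t' * (uR N e.idx * uR N f.idx))) =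
      Real.exp ((β : ℝ) * μ) * Real.exp (-2 * (β : ℝ) * uR N e.idx) * Real.exp (-2 * (β : ℝ) * uR N f.idx) *
        Real.exp (4 * (β : ℝ) * t' * (uR N e.idx * uR N f.idx)) := by
    rw [← Real.exp_add, ← Real.exp_add, ← Real.exp_add]; ring_nf
  have hgdef : gRTT' β t' μ (uR N e.idx) (uR N f.idx) = 2 * Real.log (1 + Real.exp ((wq : ℚ) : ℝ)) := by
    unfold gRTT'; rw [hw]
  rw [hgdef]
  unfold gBoundTT'
  rw [← hwq]
  by_cases hw0 : wq ≤ 0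
  · rw [if_pos hw0]
    apply cast_le_rup
    push_cast
    have hE : Real.exp ((wq : ℚ) : ℝ) ≤
        ((rup (rup (rup (emu.2 * e.ehi) * f.ehi) * expUpper (yPair β t' N e.idx f.idx)) : ℚ) : ℝ) := by
      apply cast_le_rup; push_cast
      rw [hw, hfac]
      have h1 : Real.exp ((β : ℝ) * μ) * Real.exp (-2 * (β : ℝ) * uR N e.idx) ≤ ((rup (emu.2 * e.ehi) : ℚ) : ℝ) := by
        apply cast_le_rup; push_cast
        exact mul_le_mul hmu2 he2 (Real.exp_pos _).le ((Real.exp_pos _).le.trans hmu2)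
      have h12pos : 0 ≤ Real.exp ((β : ℝ) * μ) * Real.exp (-2 * (β : ℝ) * uR N e.idx) := by positivity
      have h2 : Real.exp ((β : ℝ) * μ) * Real.exp (-2 * (β : ℝ) * uR N e.idx) * Real.exp (-2 * (β : ℝ) * uR N f.idx) ≤
          ((rup (rup (emu.2 * e.ehi) * f.ehi) : ℚ) : ℝ) := by
        apply cast_le_rup; push_cast
        exact mul_le_mul h1 hf2 (Real.exp_pos _).le (h12pos.trans h1)
      have h123pos : 0 ≤ Real.exp ((β : ℝ) * μ) * Real.exp (-2 * (β : ℝ) * uR N e.idx) *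
          Real.exp (-2 * (β : ℝ) * uR N f.idx) := by positivity
      exact mul_le_mul h2 hyU (Real.exp_pos _).le (h123pos.trans h2)
    have hle1 : Real.exp ((wq : ℚ) : ℝ) ≤ 1 := Real.exp_le_one_iff.2 (by exact_mod_cast hw0)
    have h := log_one_add_le_log1pUpper (Real.exp_pos _).le hle1 hE
    linarith
  · rw [if_neg hw0]
    apply cast_le_rup
    push_cast
    have hwpos : 0 < ((wq : ℚ) : ℝ) := by exact_mod_cast lt_of_not_ge hw0
    have hsplit : Real.log (1 + Real.exp ((wq : ℚ) : ℝ)) =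
        ((wq : ℚ) : ℝ) + Real.log (1 + Real.exp (-((wq : ℚ) : ℝ))) := by
      have hpos := Real.exp_pos ((wq : ℚ) : ℝ)
      have : 1 + Real.exp ((wq : ℚ) : ℝ) = Real.exp ((wq : ℚ) : ℝ) * (1 + Real.exp (-((wq : ℚ) : ℝ))) := by
        rw [mul_add, mul_one, ← Real.exp_add, add_neg_cancel, Real.exp_zero]; ring
      rw [this, Real.log_mul hpos.ne' (by positivity), Real.log_exp]
    rw [hsplit]
    have hneg1 : Real.exp (-((wq : ℚ) : ℝ)) ≤ 1 := Real.exp_le_one_iff.2 (by linarith)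
    have hneg0 := (Real.exp_pos (-((wq : ℚ) : ℝ))).le
    set dq : ℚ := rdn (rdn (rdn (emu.1 * e.elo) * f.elo) * expLower (yPair β t' N e.idx f.idx)) with hdq
    by_cases hd : 0 < dq
    · rw [if_pos hd]
      have hdR : (0 : ℝ) < ((dq : ℚ) : ℝ) := by exact_mod_cast hd
      -- the lower product is below `e^w`
      have hr1 : 0 ≤ ((rdn (emu.1 * e.elo) : ℚ) : ℝ) := by
        exact_mod_cast rdn_nonneg (mul_nonneg (le_of_lt (by exact_mod_cast hmu0)) (le_of_lt (by exact_mod_cast he0)))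
      have h1 : ((rdn (emu.1 * e.elo) : ℚ) : ℝ) ≤ Real.exp ((β : ℝ) * μ) * Real.exp (-2 * (β : ℝ) * uR N e.idx) := by
        apply rdn_cast_le; push_cast
        exact mul_le_mul hmu1 he1 he0.le (Real.exp_pos _).le
      have hr2 : 0 ≤ ((rdn (rdn (emu.1 * e.elo) * f.elo) : ℚ) : ℝ) := by
        have : 0 ≤ rdn (emu.1 * e.elo) := by exact_mod_cast hr1
        exact_mod_cast rdn_nonneg (mul_nonneg this (le_of_lt (by exact_mod_cast hf0)))
      have h2 : ((rdn (rdn (emu.1 * e.elo) * f.elo) : ℚ) : ℝ) ≤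
          Real.exp ((β : ℝ) * μ) * Real.exp (-2 * (β : ℝ) * uR N e.idx) * Real.exp (-2 * (β : ℝ) * uR N f.idx) := by
        apply rdn_cast_le; push_cast
        exact mul_le_mul h1 hf1 hf0.le (by positivity)
      have hdle : ((dq : ℚ) : ℝ) ≤ Real.exp ((wq : ℚ) : ℝ) := by
        rw [hdq]
        apply rdn_cast_le; push_cast
        rw [hw, hfac]
        exact mul_le_mul h2 hyL hyL0 (by positivity)
      have hE : Real.exp (-((wq : ℚ) : ℝ)) ≤ ((rup (1 / dq) : ℚ) : ℝ) := by
        apply cast_le_rup; push_cast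
        rw [Real.exp_neg, ← one_div]
        exact one_div_le_one_div_of_le hdR hdle
      have h := log_one_add_le_log1pUpper hneg0 hneg1 hE
      linarith
    · rw [if_neg hd]
      have h2 : Real.log (1 + Real.exp (-((wq : ℚ) : ℝ))) ≤ Real.log 2 :=
        Real.log_le_log (by positivity) (by linarith)
      linarith [log_two_le_log2Hi']

/-! ### §3 The checker and the soundness theorem -/

/-- `sumOver` is the indexed sum over `getD` (re-proved: private upstream). [cite: DavisRabinowitz1984, Sect. 2.1] -/
private theorem sumOver_eq' (L : List Entry) (f : Entry → ℚ) (d : Entry) :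
    sumOver L f = ∑ i ∈ Finset.range L.length, f (L.getD i d) := by
  induction L with
  | nil => simp [sumOver]
  | cons x t ih =>
    rw [sumOver, ih, List.length_cons, Finset.sum_range_succ']
    simp only [List.getD_cons_succ, List.getD_cons_zero]
    ring

/-- Row sum `Σ_f Ω⁺_f · G(e,f)` for the `t–t'` table bound. [cite: DavisRabinowitz1984, Sect. 2.1] -/
def rowSumTT' (β t' μ : ℚ) (N : ℕ) (emu : ℚ × ℚ) (L : List Entry) (e : Entry) : ℚ :=
  sumOver L fun f => f.om * gBoundTT' β t' μ N emu e f

/-- Total `Σ_e Ω⁺_e · rup(rowSumTT' e)`. [cite: DavisRabinowitz1984, Sect. 2.1] -/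
def totalSumTT' (β t' μ : ℚ) (N : ℕ) (emu : ℚ × ℚ) (L : List Entry) : ℚ :=
  sumOver L fun e => e.om * rup (rowSumTT' β t' μ N emu L e)

/-- **The certificate checker** for `P₀(β, t', μ) ≤ P` (`N ≥ 1`, table of `2N+1` entries as in `FreeGCQuadrature.check`, `emu` an
enclosure of `e^{βμ}`, and `|4βt'| ≤ 32` for the pair factors). [cite: DavisRabinowitz1984, Sect. 2.1] -/
def checkTT' (β t' μ : ℚ) (N : ℕ) (emu : ℚ × ℚ) (L : List Entry) (P : ℚ) : Bool :=
  decide (1 ≤ N) && decide (L.length = 2 * N + 1) && entriesOK β N 0 L &&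
    decide (|β * μ| ≤ 32) && decide (|2 * β| ≤ 32) && decide (|4 * β * t'| ≤ 32) && decide (0 ≤ P) &&
    decide (0 < (expPos |β * μ|).1) && decide (0 < emu.1) &&
    decide (emu.1 ≤ (expEncl (β * μ)).1) && decide ((expEncl (β * μ)).2 ≤ emu.2) &&
    decide (totalSumTT' β t' μ N emu L ≤ 4 * piLo * piLo * P)

/-- Unpacking `entriesOK` (re-proved: private upstream). [cite: DavisRabinowitz1984, Sect. 2.1] -/
private theorem entriesOK_get' {β : ℚ} {N : ℕ} (d : Entry) :
    ∀ (L : List Entry) (i : ℕ), entriesOK β N i L = true →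
      ∀ k < L.length, (L.getD k d).idx = i + k ∧ entryOK β N (L.getD k d) = true := by
  intro L
  induction L with
  | nil => intro i _ k hk; simp at hk
  | cons e t ih =>
    intro i h k hk
    simp only [entriesOK, Bool.and_eq_true, decide_eq_true_eq] at h
    obtain ⟨⟨h1, h2⟩, h3⟩ := h
    cases k with
    | zero => simpa using ⟨h1, h2⟩
    | succ k =>
      have hk' : k < t.length := by simpa using hk
      have := ih (i + 1) h3 k hk'
      simp only [List.getD_cons_succ]
      exact ⟨by rw [this.1]; ring, this.2⟩

/-- **Soundness of the checker**: `checkTT' β t' μ N emu L P = true →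
(2π)⁻² ∫_{[−π,π]²} 2 log(1 + e^{−β(2 Σᵢ cos kᵢ − 4 t' cos k₀ cos k₁ − μ)}) dk ≤ P` (the left side is `freeGCPressureTT' β t' μ` of
`HubbardTTPrimeFreeGCPressure`, by `unfold`). [cite: DavisRabinowitz1984, Sect. 2.1] [cite: AshcroftMermin1976, Ch. 2 eq. (2.49)] -/
theorem integral_le_of_checkTT' (β t' μ : ℚ) (N : ℕ) (emu : ℚ × ℚ) (L : List Entry) (P : ℚ)
    (h : checkTT' β t' μ N emu L P = true) :
    ((2 * π) ^ 2)⁻¹ * ∫ k in brillouin 2,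
        2 * Real.log (1 + Real.exp (-((β : ℝ) * (2 * ∑ i, Real.cos (k i) - 4 * (t' : ℝ) * (Real.cos (k 0) * Real.cos (k 1))
          - (μ : ℝ))))) ≤ ((P : ℚ) : ℝ) := by
  simp only [checkTT', Bool.and_eq_true, decide_eq_true_eq] at h
  obtain ⟨⟨⟨⟨⟨⟨⟨⟨⟨⟨⟨hN, hlen⟩, hent⟩, hbμ⟩, hb2⟩, hb4⟩, hP0⟩, hposμ⟩, hemu0⟩, hemu1⟩, hemu2⟩, htot⟩ := h
  set M := 2 * N with hM
  have hM1 : 1 ≤ M := by omega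
  let d : Entry := ⟨0, 0, 0, 0⟩
  have hget := entriesOK_get' d L 0 hent
  have hidx : ∀ p ≤ M, (L.getD p d).idx = p := fun p hp => by
    have := (hget p (by rw [hlen]; omega)).1; simpa using this
  have hE : ∀ p ≤ M, entryOK β N (L.getD p d) = true := fun p hp => (hget p (by rw [hlen]; omega)).2
  have hemu : ExpOK ((β : ℝ) * μ) emu.1 emu.2 := by
    have h := expEncl_spec (β * μ) hbμ hposμ
    push_cast at h
    exact ⟨by exact_mod_cast hemu0, (by exact_mod_cast hemu1 : ((emu.1 : ℚ) : ℝ) ≤ ((expEncl (β * μ)).1 : ℝ)).trans h.1,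
      h.2.trans (by exact_mod_cast hemu2)⟩
  have hEe : ∀ p ≤ M, ExpOK (-2 * (β : ℝ) * uR N (L.getD p d).idx) (L.getD p d).elo (L.getD p d).ehi ∧
      omegaPlus N p ≤ (L.getD p d).om ∧ 0 ≤ (L.getD p d).om := by
    intro p hp
    have h := hE p hp
    simp only [entryOK, Bool.and_eq_true, decide_eq_true_eq] at h
    obtain ⟨⟨⟨⟨⟨h1, h2⟩, h3⟩, h4⟩, h5⟩, h6⟩ := h
    rw [hidx p hp] at h1 h3 h4 h5 ⊢
    have hy : |(-2) * β * nodeU N p| ≤ 32 := by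
      rw [abs_mul]
      have hu : |nodeU N p| ≤ 1 := by
        have h01 := uR_zero_and_last hN
        have hmono : ∀ a b, a ≤ b → b ≤ M → uR N a ≤ uR N b := by
          intro a b hab hbM
          induction b, hab using Nat.le_induction with
          | base => exact le_rfl
          | succ b hab ih => exact (ih (by omega)).trans (uR_lt_succ hN b (by omega)).le
        have hlo := hmono 0 p (Nat.zero_le _) hp
        have hhi := hmono p M hp le_rfl
        rw [h01.1] at hlo; rw [h01.2] at hhi
        unfold uR at hlo hhi
        rw [abs_le]
        exact ⟨by exact_mod_cast hlo, by exact_mod_cast hhi⟩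
      calc |(-2) * β| * |nodeU N p| ≤ |(-2) * β| * 1 := mul_le_mul_of_nonneg_left hu (abs_nonneg _)
        _ = |2 * β| := by rw [mul_one, show (-2) * β = -(2 * β) by ring, abs_neg]
        _ ≤ 32 := hb2
    have hsp := expEncl_spec ((-2) * β * nodeU N p) hy h3
    have hcast : ((((-2) * β * nodeU N p : ℚ)) : ℝ) = -2 * (β : ℝ) * uR N p := by unfold uR; push_cast; ring
    rw [hcast] at hsp
    exact ⟨⟨by exact_mod_cast h6, (by exact_mod_cast h4 : (((L.getD p d).elo : ℚ) : ℝ) ≤ _).trans hsp.1,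
      hsp.2.trans (by exact_mod_cast h5)⟩, h1, h2⟩
  -- the analytic inequality
  obtain ⟨hg0, hgc, hga, hgb⟩ := gRTT'_props β t' μ
  have h01 := uR_zero_and_last hN
  let G : ℕ → ℕ → ℝ := fun p q => ((gBoundTT' β t' μ N emu (L.getD p d) (L.getD q d) : ℚ) : ℝ)
  have hG : ∀ p ≤ M, ∀ q ≤ M, gRTT' β t' μ (uR N p) (uR N q) ≤ G p q := by
    intro p hp q hq
    have h := gRTT'_le_gBoundTT' β t' μ N hN emu (L.getD p d) (L.getD q d) hemu (hEe p hp).1 (hEe q hq).1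
      (by rw [hidx p hp]; exact hp) (by rw [hidx q hq]; exact hq) hb4
    rwa [hidx p hp, hidx q hq] at h
  have hG0 : ∀ p ≤ M, ∀ q ≤ M, 0 ≤ G p q := fun p hp q hq => (hg0 _ _).trans (hG p hp q hq)
  have hquad := setIntegral_brillouin_two_le_sum_hat hM1 (fun p hp => uR_lt_succ hN p hp) h01.1 h01.2 hgc hg0 hga hgb hG
  -- the integrand is the `t–t'` free log-weight
  have hfun : ∀ k : Fin 2 → ℝ,
      2 * Real.log (1 + Real.exp (-((β : ℝ) * (2 * ∑ i, Real.cos (k i) - 4 * (t' : ℝ) * (Real.cos (k 0) * Real.cos (k 1))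
        - (μ : ℝ))))) = gRTT' β t' μ (Real.cos (k 0)) (Real.cos (k 1)) := by
    intro k
    simp only [gRTT', Fin.sum_univ_two]
    congr 3
    ring
  have hI : ∫ k in brillouin 2, 2 * Real.log (1 + Real.exp (-((β : ℝ) * (2 * ∑ i, Real.cos (k i) -
      4 * (t' : ℝ) * (Real.cos (k 0) * Real.cos (k 1)) - (μ : ℝ))))) =
      ∫ k in brillouin 2, gRTT' β t' μ (Real.cos (k 0)) (Real.cos (k 1)) :=
    setIntegral_congr_fun (measurableSet_brillouin 2) fun k _ => hfun k
  -- bounding the double sum by the checker's total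
  set om : ℕ → ℝ := fun p => (((L.getD p d).om : ℚ) : ℝ) with hom
  have hΩ : ∀ p ≤ M, omegaR N p ≤ om p ∧ 0 ≤ om p := fun p hp => by
    simp only [hom]
    exact ⟨(omegaR_le_omegaPlus hN p hp).trans (by exact_mod_cast (hEe p hp).2.1), by exact_mod_cast (hEe p hp).2.2⟩
  have hsum1 : ∑ p ∈ Finset.range (M + 1), ∑ q ∈ Finset.range (M + 1), G p q * omegaR N p * omegaR N q ≤
      ∑ p ∈ Finset.range (M + 1), om p * ∑ q ∈ Finset.range (M + 1), om q * G p q := by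
    refine Finset.sum_le_sum fun p hp => ?_
    have hpM : p ≤ M := Nat.lt_succ_iff.1 (Finset.mem_range.1 hp)
    rw [Finset.mul_sum]
    refine Finset.sum_le_sum fun q hq => ?_
    have hqM : q ≤ M := Nat.lt_succ_iff.1 (Finset.mem_range.1 hq)
    have h1 : G p q * omegaR N p * omegaR N q ≤ G p q * om p * omegaR N q :=
      mul_le_mul_of_nonneg_right (mul_le_mul_of_nonneg_left (hΩ p hpM).1 (hG0 p hpM q hqM)) (omegaR_nonneg q)
    have h2 : G p q * om p * omegaR N q ≤ G p q * om p * om q :=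
      mul_le_mul_of_nonneg_left (hΩ q hqM).1 (mul_nonneg (hG0 p hpM q hqM) (hΩ p hpM).2)
    linarith
  have hrow : ∀ p ≤ M, ∑ q ∈ Finset.range (M + 1), om q * G p q =
      ((rowSumTT' β t' μ N emu L (L.getD p d) : ℚ) : ℝ) := by
    intro p _
    rw [rowSumTT', sumOver_eq' L _ d, hlen]
    push_cast
    rfl
  have hsum2 : ∑ p ∈ Finset.range (M + 1), om p * ∑ q ∈ Finset.range (M + 1), om q * G p q ≤
      ((totalSumTT' β t' μ N emu L : ℚ) : ℝ) := by
    rw [totalSumTT', sumOver_eq' L _ d, hlen]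
    push_cast
    refine Finset.sum_le_sum fun p hp => ?_
    have hpM : p ≤ M := Nat.lt_succ_iff.1 (Finset.mem_range.1 hp)
    rw [hrow p hpM]
    exact mul_le_mul_of_nonneg_left (by exact_mod_cast le_rup _) (hΩ p hpM).2
  have htotR : ((totalSumTT' β t' μ N emu L : ℚ) : ℝ) ≤ 4 * piLo * piLo * P := by exact_mod_cast htot
  -- assemble
  have hπ := Real.pi_gt_d20
  have hpiLo : ((piLo : ℚ) : ℝ) ≤ π := by push_cast [piLo]; linarith
  have hpiLo0 : (0 : ℝ) ≤ piLo := by push_cast [piLo]; norm_num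
  have hP0R : (0 : ℝ) ≤ P := by exact_mod_cast hP0
  have hI_le : ∫ k in brillouin 2, 2 * Real.log (1 + Real.exp (-((β : ℝ) * (2 * ∑ i, Real.cos (k i) -
      4 * (t' : ℝ) * (Real.cos (k 0) * Real.cos (k 1)) - (μ : ℝ))))) ≤ 4 * π * π * P := by
    rw [hI]
    refine (hquad.trans (hsum1.trans (hsum2.trans (htotR.trans ?_))))
    have := mul_le_mul hpiLo hpiLo hpiLo0 Real.pi_pos.le
    nlinarith
  have h4 : (0 : ℝ) < (2 * π) ^ 2 := by positivity
  rw [inv_mul_le_iff₀ h4]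
  nlinarith [hI_le, Real.pi_pos]

end FreeGCQuadrature

end Literature.MathematicalPhysics.QuantumLattice

end
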